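import Mathlib
import Literature.NumberTheory.Sieve.Maynard2016SystemCRT
import HarnessLib

/-!
# Maynard (2016), Lemma 7: the linear congruence system in `q` is ONE residue class — p. 12

Trunk: AntSieve / parity (Maynard 2016 large-gaps ladder; named fact
`Literature.NumberTheory.Sieve.Maynard2016.Lemma7Tuple`).

J. Maynard, *Large gaps between primes*, Ann. of Math. 183 (2016) = arXiv:1408.5110, §6, proof of
Lemma 7, the paragraph after (6.27) (p. 12): after the expansion of the square (display (6.27),
`Maynard2016Lemma7Link.sum_divSum_sub_sq_eq_sum_rbox`) the inner sum runs over the primes `q ∈ 𝓘_m`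
with `[d_j,d'_j] ∣ p₀ + (h_j − h_i) q`, `[e_j,e'_j] ∣ m p₀ − 1 + m (h_j − h_i) q`, `q ≡ w₀ (mod P_w)`,
every condition being a LINEAR congruence `D ∣ P + A q` in `q`.  "If all of these conditions are
satisfied, then the inner sum can be rewritten as a sum over primes in `𝓘_m` in a single residue
class modulo the least common multiple …".

PROVED here, in the generality of linear congruences `(D : ℤ) ∣ P + A q` for `q : ℕ`:
* `periodic_intDvd_linear` — the condition is `D`-periodic in `q`;
* `card_filter_range_intDvd_linear_eq_one` — for `A` coprime to `D` it has exactly one solution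
  `q (mod D)`; `not_intDvd_linear_of_not_dvd` — no solution at all if `gcd(A, D) ∤ P`;
* `card_filter_range_linearSystem_eq_one` — a finite system with pairwise coprime moduli and unit
  coefficients has exactly one solution modulo `∏ D_i` (the tree's generic Chinese remainder count
  `Maynard2016SystemCRT.card_filter_range_prod_of_pairwise_coprime`);
* `exists_linearSystem_iff_mod_eq` — hence the system is equivalent to `q % (∏ D_i) = c` for one
  `c < ∏ D_i` ("a single residue class modulo the least common multiple").

## References

* J. Maynard, *Large gaps between primes*, Ann. of Math. (2) 183 (2016), 915–933; arXiv:1408.5110,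
  §6, proof of Lemma 7, p. 12 (paragraph after (6.27)). [Maynard2016LargeGaps]
-/

open Finset
open scoped BigOperators

namespace Literature.NumberTheory.Sieve

namespace Maynard2016

/-! ### One linear congruence -/

/-- `q ↦ (D ∣ P + A q)` is `D`-periodic. [cite: Maynard2016LargeGaps, Lemma 7 (proof, p. 12)] -/
theorem periodic_intDvd_linear (D : ℕ) (P A : ℤ) :
    Function.Periodic (fun q : ℕ => (D : ℤ) ∣ P + A * q) D := by
  intro q
  simp only [Nat.cast_add]
  have h : P + A * ((q : ℤ) + D) = (P + A * q) + D * A := by ring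
  rw [h]
  exact propext (dvd_add_left (dvd_mul_right (D : ℤ) A))

/-- If `gcd(A, D) ∤ P` there is no solution. [cite: Maynard2016LargeGaps, Lemma 7 (proof, p. 12)] -/
theorem not_intDvd_linear_of_not_dvd {D : ℕ} {P A : ℤ} (h : ¬ ((Int.gcd A D : ℕ) : ℤ) ∣ P) (q : ℕ) :
    ¬ (D : ℤ) ∣ P + A * q := by
  intro hq
  apply h
  have h1 : ((Int.gcd A D : ℕ) : ℤ) ∣ (D : ℤ) := Int.gcd_dvd_right _ _
  have h2 : ((Int.gcd A D : ℕ) : ℤ) ∣ A := Int.gcd_dvd_left _ _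
  have h3 : ((Int.gcd A D : ℕ) : ℤ) ∣ P + A * q := h1.trans hq
  exact (dvd_add_left (h2.mul_right (q : ℤ))).1 h3

/-- In `ZMod D`: `D ∣ P + A q ↔ (P : ZMod D) + A q = 0`. [folklore] -/
private theorem intDvd_linear_iff_zmod (D : ℕ) (P A : ℤ) (q : ℕ) :
    (D : ℤ) ∣ P + A * q ↔ ((P : ZMod D) + (A : ZMod D) * (q : ZMod D) = 0) := by
  rw [← ZMod.intCast_zmod_eq_zero_iff_dvd]
  push_cast
  rfl

/-- **One solution modulo `D`** when `A` is coprime to `D` (`D ≥ 1`).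
[cite: Maynard2016LargeGaps, Lemma 7 (proof, p. 12)] -/
theorem card_filter_range_intDvd_linear_eq_one {D : ℕ} (hD : 0 < D) {P A : ℤ}
    (hA : IsCoprime A (D : ℤ)) :
    ((Finset.range D).filter (fun q : ℕ => (D : ℤ) ∣ P + A * q)).card = 1 := by
  classical
  haveI : NeZero D := ⟨hD.ne'⟩
  -- `A` is a unit mod `D`
  have hu : IsUnit (A : ZMod D) := by
    obtain ⟨u, v, huv⟩ := hA
    refine isUnit_iff_exists_inv.2 ⟨(u : ZMod D), ?_⟩
    have := congrArg (fun z : ℤ => (z : ZMod D)) huv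
    push_cast at this
    rw [ZMod.natCast_self, mul_zero, add_zero] at this
    rw [mul_comm]; exact this
  obtain ⟨a, ha⟩ := hu
  -- the solution class
  set c : ZMod D := -(P : ZMod D) * (↑a⁻¹ : ZMod D) with hc
  have hiff : ∀ q : ℕ, (D : ℤ) ∣ P + A * q ↔ (q : ZMod D) = c := by
    intro q
    rw [intDvd_linear_iff_zmod, ← ha]
    constructor
    · intro h
      have h' : (a : ZMod D) * (q : ZMod D) = -(P : ZMod D) := by
        linear_combination h
      calc (q : ZMod D) = (↑a⁻¹ * a : ZMod D) * q := by rw [Units.inv_mul, one_mul]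
        _ = ↑a⁻¹ * ((a : ZMod D) * q) := by ring
        _ = c := by rw [h', hc]; ring
    · intro h
      rw [h, hc]
      calc (P : ZMod D) + (a : ZMod D) * (-(P : ZMod D) * ↑a⁻¹)
          = (P : ZMod D) - (P : ZMod D) * ((a : ZMod D) * ↑a⁻¹) := by ring
        _ = 0 := by rw [Units.mul_inv, mul_one, sub_self]
  have hset : (Finset.range D).filter (fun q : ℕ => (D : ℤ) ∣ P + A * q) = {c.val} := by
    ext q
    simp only [Finset.mem_filter, Finset.mem_range, Finset.mem_singleton, hiff]
    constructor
    · rintro ⟨hq, hqc⟩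
      rw [← hqc, ZMod.val_natCast, Nat.mod_eq_of_lt hq]
    · rintro rfl
      exact ⟨ZMod.val_lt c, ZMod.natCast_zmod_val c⟩
  rw [hset, Finset.card_singleton]

/-! ### A system of linear congruences with pairwise coprime moduli -/

/-- **Exactly one solution modulo `∏ D_i`** for a system `D_i ∣ P_i + A_i q` (`i ∈ s`) with pairwise
coprime moduli `D_i ≥ 1` and `A_i` coprime to `D_i`. [cite: Maynard2016LargeGaps, Lemma 7 (proof, p. 12)] -/
theorem card_filter_range_linearSystem_eq_one {ι : Type*} [DecidableEq ι] (s : Finset ι)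
    (D : ι → ℕ) (P A : ι → ℤ) (hD : ∀ i ∈ s, 0 < D i)
    (hcop : (s : Set ι).Pairwise fun i j => (D i).Coprime (D j))
    (hA : ∀ i ∈ s, IsCoprime (A i) (D i : ℤ)) :
    ((Finset.range (∏ i ∈ s, D i)).filter
        (fun q : ℕ => ∀ i ∈ s, (D i : ℤ) ∣ P i + A i * q)).card = 1 := by
  classical
  rw [card_filter_range_prod_of_pairwise_coprime s D (fun i q => (D i : ℤ) ∣ P i + A i * q) hD hcop
    (fun i _ => periodic_intDvd_linear (D i) (P i) (A i))]
  exact Finset.prod_eq_one fun i hi => card_filter_range_intDvd_linear_eq_one (hD i hi) (hA i hi)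

/-- A periodic predicate with exactly one solution per period is one residue class. [folklore] -/
private theorem exists_iff_mod_eq_of_card_eq_one {M : ℕ} (hM : 0 < M) {R : ℕ → Prop}
    [DecidablePred R] (hR : Function.Periodic R M)
    (hcard : ((Finset.range M).filter R).card = 1) :
    ∃ c, c < M ∧ ∀ q, R q ↔ q % M = c := by
  obtain ⟨c, hc⟩ := Finset.card_eq_one.1 hcard
  have hcmem : c ∈ (Finset.range M).filter R := by rw [hc]; exact Finset.mem_singleton_self c
  refine ⟨c, Finset.mem_range.1 (Finset.mem_filter.1 hcmem).1, fun q => ?_⟩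
  have hper : R (q % M) ↔ R q := by rw [hR.map_mod_nat q]
  constructor
  · intro hq
    have hmem : q % M ∈ (Finset.range M).filter R :=
      Finset.mem_filter.2 ⟨Finset.mem_range.2 (Nat.mod_lt q hM), hper.2 hq⟩
    rw [hc] at hmem
    exact Finset.mem_singleton.1 hmem
  · intro hq
    rw [← hq] at hcmem
    exact hper.1 (Finset.mem_filter.1 hcmem).2

/-- **"A single residue class modulo the least common multiple"**: under the hypotheses of
`card_filter_range_linearSystem_eq_one` there is `c < ∏ D_i` with
`(∀ i ∈ s, D_i ∣ P_i + A_i q) ↔ q % ∏ D_i = c` for every `q`. [cite: Maynard2016LargeGaps, Lemma 7 (proof, p. 12)] -/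
theorem exists_linearSystem_iff_mod_eq {ι : Type*} [DecidableEq ι] (s : Finset ι)
    (D : ι → ℕ) (P A : ι → ℤ) (hD : ∀ i ∈ s, 0 < D i)
    (hcop : (s : Set ι).Pairwise fun i j => (D i).Coprime (D j))
    (hA : ∀ i ∈ s, IsCoprime (A i) (D i : ℤ)) :
    ∃ c, c < ∏ i ∈ s, D i ∧
      ∀ q : ℕ, (∀ i ∈ s, (D i : ℤ) ∣ P i + A i * q) ↔ q % (∏ i ∈ s, D i) = c := by
  classical
  exact exists_iff_mod_eq_of_card_eq_one (Finset.prod_pos hD)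
    (periodic_forall_of_dvd s D (fun i q => (D i : ℤ) ∣ P i + A i * q)
      (fun i _ => periodic_intDvd_linear (D i) (P i) (A i)) fun i hi => Finset.dvd_prod_of_mem _ hi)
    (card_filter_range_linearSystem_eq_one s D P A hD hcop hA)

/-- **Coprimality of the coefficient is forced by solvability at a prime `P`:** if `D ∣ P + A q` with
`P = p₀` a prime exceeding `D ≥ 1`, then `gcd(A, D) = 1` (so the previous statements apply to the
`d`-side conditions `[d_j,d'_j] ∣ p₀ + (h_j − h_i) q`). [cite: Maynard2016LargeGaps, Lemma 7 (proof, p. 12)] -/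
theorem isCoprime_of_intDvd_linear_prime {D p₀ : ℕ} (hp₀ : p₀.Prime) (hD0 : 0 < D) (hDp : D < p₀)
    {A : ℤ} {q : ℕ} (h : (D : ℤ) ∣ (p₀ : ℤ) + A * q) : IsCoprime A (D : ℤ) := by
  rw [Int.isCoprime_iff_gcd_eq_one]
  set g := Int.gcd A D with hg
  have hgD : (g : ℤ) ∣ (D : ℤ) := Int.gcd_dvd_right _ _
  have hgA : (g : ℤ) ∣ A := Int.gcd_dvd_left _ _
  have hgp : (g : ℤ) ∣ (p₀ : ℤ) := by
    have h3 : (g : ℤ) ∣ (p₀ : ℤ) + A * q := hgD.trans h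
    exact (dvd_add_left (hgA.mul_right (q : ℤ))).1 h3
  have hgp' : g ∣ p₀ := by exact_mod_cast hgp
  have hgD' : g ∣ D := by exact_mod_cast hgD
  rcases (Nat.dvd_prime hp₀).1 hgp' with h1 | h1
  · exact h1
  · exfalso
    have : g ≤ D := Nat.le_of_dvd hD0 hgD'
    omega

/-- For the `e`-side conditions `E ∣ (m p₀ − 1) + m (h_j − h_i) q` solvability does not by itself
force a unit coefficient; the typed minimal criterion used instead: if `gcd(B, E) ∣ N` (necessary for
a solution of `E ∣ N + B q`, `not_intDvd_linear_of_not_dvd`) and `gcd(N, B) = 1`, then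
`gcd(B, E) = 1`. [cite: Maynard2016LargeGaps, Lemma 7 (proof, p. 12)] -/
theorem isCoprime_of_gcd_dvd_of_isCoprime {E : ℕ} {N B : ℤ} (hg : ((Int.gcd B E : ℕ) : ℤ) ∣ N)
    (hNB : IsCoprime N B) : IsCoprime B (E : ℤ) := by
  rw [Int.isCoprime_iff_gcd_eq_one]
  have hgB : ((Int.gcd B E : ℕ) : ℤ) ∣ B := Int.gcd_dvd_left _ _
  have hunit := hNB.isUnit_of_dvd' hg hgB
  have : (Int.gcd B E : ℤ).natAbs = 1 := Int.isUnit_iff_natAbs_eq.1 hunit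
  simpa using this

end Maynard2016

end Literature.NumberTheory.Sieve
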